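import Literature.Analysis.FunctionSpaces.TimeMollification
import HarnessLib

/-!
# Mollified pairings: the `L¹_t L²_x`–`L^∞_t L²_x` case

Analysis/FunctionSpaces support file (serves the FORCED twin of the Serrin–Prodi weak–strong
uniqueness theorem, `Literature.Analysis.FluidPDE.sohr2001_serrinMasuda_uniqueness_forced_memLp`
(Sohr 2001, Thm. V.1.5.1): in Serrin's cross-identity argument (Serrin 1963, §4) with a force
`f ∈ L¹(0,T; L²)`, testing the time-mollified weak formulation of one Leray–Hopf solution with the
other produces, besides the `L²`–`L²` gradient pairings and the trilinear terms of the unforced case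
(the accepted `tendsto_integral_normed_mul_integral_inner` and `…_of_bound`), the mollified force
pairings `∫∫ ρₙ(s - σ) ⟨f(s), v(σ)⟩_{L²} dσ ds` with `f ∈ L¹_t L²_x` and `v ∈ L^∞_t L²_x` only).

**Main result** (`tendsto_integral_normed_mul_integral_inner_of_L1`). Let `A, Φ : ℝ × X → V` be
jointly measurable, `∫_{(0,t)} ‖A(σ)‖_{L²(X)} dσ < ∞`, `‖Φ(s)‖_{L²(X)} ≤ C < ∞` for a.e.
`s ∈ (0,t)`, and let `ρₙ` be normalised bump kernels with `rOut(ρₙ) → 0`. Then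
`∫∫_{(0,t)²} ρₙ(s - σ) ⟨Φ(s), A(σ)⟩_{L²(X)} dσ ds → ∫_{(0,t)} ⟨Φ(s), A(s)⟩_{L²(X)} ds`;
the same with the roles of the two time-integrability classes exchanged
(`tendsto_integral_normed_mul_integral_inner_of_L1'`). Proof: truncate `A` IN TIME at slice norm
`M` (`A = A·1_{‖A(σ)‖₂ ≤ M} + A·1_{‖A(σ)‖₂ > M}`); the truncated part is in `L²((0,t) × X)` and the
accepted `L²`–`L²` lemma applies; the remainder is bounded, uniformly in `n`, by
`C ∫_{‖A(σ)‖₂ > M} ‖A(σ)‖₂ dσ → 0` (`M → ∞`), using `∫ ρₙ(s - σ) ds ≤ 1`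
(`enorm_integral_normed_mul_integral_inner_le`); an `ε/3` argument concludes.

## Mathlib / tree search

Mathlib: Tonelli/Fubini (`lintegral_prod`, `integral_prod_swap`), dominated convergence for `∫⁻`
(`tendsto_lintegral_of_dominated_convergence`); no mollified-pairing statements. Tree
(`TimeMollification`): the `L²`–`L²` and `L¹`–`L^∞` (pointwise bound) pairing limits, slice-norm
measurability `measurable_eLpNorm_slice`, the kernel masses `lintegral_ofReal_normed_sub_right/left`,
Cauchy–Schwarz `enorm_integral_inner_le_eLpNorm_mul` — all reused; the present class
(`L¹_tL²_x` against `L^∞_tL²_x`) is not covered there (searched `of_L1`, `L1L2`, `normed_mul_integral`).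

## References

* J. Serrin, *The initial value problem for the Navier–Stokes equations*, in: Nonlinear Problems
  (Madison 1962), Univ. Wisconsin Press 1963, §4 (`Serrin1963`).
* H. Sohr, *The Navier–Stokes Equations. An Elementary Functional Analytic Approach*, Birkhäuser
  2001, Ch. V, Thm. 1.5.1 and proof of Thm. 1.4.1 (`Sohr2001`).
-/

noncomputable section

open MeasureTheory TopologicalSpace Set Function Filter Topology ContinuousLinearMap
open scoped ENNReal NNReal Convolution InnerProductSpace RealInnerProductSpace

namespace Literature.Analysis.FunctionSpaces

section L1Pairing

variable {X : Type*} [MeasurableSpace X] {μ : Measure X} [SFinite μ]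
variable {V : Type*} [NormedAddCommGroup V] [InnerProductSpace ℝ V] [CompleteSpace V]

omit [SFinite μ] [InnerProductSpace ℝ V] [CompleteSpace V] in
/-- A time slice of a jointly measurable field is a.e. strongly measurable. [folklore] -/
private theorem aestronglyMeasurable_slice_of_uncurry {A : ℝ → X → V}
    (hA : StronglyMeasurable (uncurry A)) (σ : ℝ) : AEStronglyMeasurable (A σ) μ :=
  (hA.comp_measurable measurable_prodMk_left).aestronglyMeasurable

omit [CompleteSpace V] in
/-- **The kernel-weighted pairing is dominated by the slice norms, uniformly in the kernel.** For
jointly measurable `B, Φ` with `‖Φ(s)‖_{L²} ≤ C` for a.e. `s ∈ (0,t)` and a normalised bump kernel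
`ρ`: `∫∫_{(0,t)²} ρ(s - σ) |⟨Φ(s), B(σ)⟩_{L²}| dσ ds ≤ C ∫_{(0,t)} ‖B(σ)‖_{L²} dσ` (Cauchy–Schwarz
in space, `∫ ρ(s - σ) ds ≤ 1`, Tonelli). [cite: Serrin1963, §4] -/
theorem lintegral_enorm_normed_mul_integral_inner_le (φ : ContDiffBump (0 : ℝ)) {t : ℝ}
    {B Φ : ℝ → X → V} (hB : StronglyMeasurable (uncurry B)) (hΦ : StronglyMeasurable (uncurry Φ))
    {C : ℝ≥0∞} (hΦC : ∀ᵐ s ∂(volume.restrict (Ioo 0 t)), eLpNorm (Φ s) 2 μ ≤ C) :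
    ∫⁻ p, ‖φ.normed volume (p.2 - p.1) * ∫ x, ⟪Φ p.2 x, B p.1 x⟫ ∂μ‖ₑ
        ∂((volume.restrict (Ioo 0 t)).prod (volume.restrict (Ioo 0 t))) ≤
      C * ∫⁻ σ in Ioo 0 t, eLpNorm (B σ) 2 μ := by
  set νt : Measure ℝ := volume.restrict (Ioo 0 t) with hνt
  set K : ℝ × ℝ → ℝ≥0∞ := fun p => ENNReal.ofReal (φ.normed volume (p.2 - p.1)) with hK
  have hKm : Measurable K :=
    ENNReal.measurable_ofReal.comp
      (φ.continuous_normed.measurable.comp (measurable_snd.sub measurable_fst))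
  set NB : ℝ → ℝ≥0∞ := fun σ => eLpNorm (B σ) 2 μ with hNB
  set NΦ : ℝ → ℝ≥0∞ := fun s => eLpNorm (Φ s) 2 μ with hNΦ
  have hNBm : Measurable NB := measurable_eLpNorm_slice hB 2
  have hNΦm : Measurable NΦ := measurable_eLpNorm_slice hΦ 2
  -- pointwise Cauchy–Schwarz
  have hpt : ∀ p : ℝ × ℝ, ‖φ.normed volume (p.2 - p.1) * ∫ x, ⟪Φ p.2 x, B p.1 x⟫ ∂μ‖ₑ ≤
      K p * (NΦ p.2 * NB p.1) := by
    intro p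
    rw [enorm_mul, Real.enorm_eq_ofReal (φ.nonneg_normed _)]
    exact mul_le_mul' le_rfl (enorm_integral_inner_le_eLpNorm_mul
      (aestronglyMeasurable_slice_of_uncurry hΦ p.2) (aestronglyMeasurable_slice_of_uncurry hB p.1))
  -- unit mass of the kernel on the restricted measure
  have hK1 : ∀ σ, ∫⁻ s, K (σ, s) ∂νt ≤ 1 := fun σ =>
    (lintegral_mono' Measure.restrict_le_self le_rfl).trans
      (lintegral_ofReal_normed_sub_right φ σ).le
  have hmeas : Measurable fun p : ℝ × ℝ => K p * (NΦ p.2 * NB p.1) :=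
    hKm.mul ((hNΦm.comp measurable_snd).mul (hNBm.comp measurable_fst))
  calc ∫⁻ p, ‖φ.normed volume (p.2 - p.1) * ∫ x, ⟪Φ p.2 x, B p.1 x⟫ ∂μ‖ₑ ∂(νt.prod νt)
      ≤ ∫⁻ p, K p * (NΦ p.2 * NB p.1) ∂(νt.prod νt) := lintegral_mono hpt
    _ = ∫⁻ σ, ∫⁻ s, K (σ, s) * (NΦ s * NB σ) ∂νt ∂νt := lintegral_prod _ hmeas.aemeasurable
    _ = ∫⁻ σ, NB σ * ∫⁻ s, K (σ, s) * NΦ s ∂νt ∂νt := by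
        refine lintegral_congr fun σ => ?_
        have hm' : AEMeasurable (fun s => K (σ, s) * NΦ s) νt :=
          ((hKm.comp measurable_prodMk_left).mul hNΦm).aemeasurable
        rw [← lintegral_const_mul'' _ hm']
        refine lintegral_congr fun s => ?_
        ring
    _ ≤ ∫⁻ σ, NB σ * (C * 1) ∂νt := by
        refine lintegral_mono fun σ => mul_le_mul' le_rfl ?_
        have hm' : AEMeasurable (fun s => K (σ, s)) νt :=
          (hKm.comp measurable_prodMk_left).aemeasurable
        calc ∫⁻ s, K (σ, s) * NΦ s ∂νt ≤ ∫⁻ s, K (σ, s) * C ∂νt := by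
              refine lintegral_mono_ae ?_
              filter_upwards [hΦC] with s hs
              exact mul_le_mul' le_rfl hs
          _ = C * ∫⁻ s, K (σ, s) ∂νt := by
              rw [← lintegral_const_mul'' _ hm']
              refine lintegral_congr fun s => ?_
              ring
          _ ≤ C * 1 := mul_le_mul' le_rfl (hK1 σ)
    _ = C * ∫⁻ σ, NB σ ∂νt := by
        rw [mul_one, ← lintegral_const_mul'' _ hNBm.aemeasurable]
        refine lintegral_congr fun σ => ?_
        ring

omit [CompleteSpace V] in
/-- **The diagonal pairing is dominated by the slice norms**: for jointly measurable `B, Φ` with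
`‖Φ(s)‖_{L²} ≤ C` for a.e. `s ∈ (0,t)`, `∫_{(0,t) × X} |⟪Φ, B⟫| ≤ C ∫_{(0,t)} ‖B(σ)‖_{L²} dσ`
(the bound on the limiting force pairing `∫⟨f, v⟩` in Serrin's identity). [cite: Serrin1963, §4] -/
theorem lintegral_enorm_inner_prod_le {t : ℝ} {B Φ : ℝ → X → V}
    (hB : StronglyMeasurable (uncurry B)) (hΦ : StronglyMeasurable (uncurry Φ))
    {C : ℝ≥0∞} (hΦC : ∀ᵐ s ∂(volume.restrict (Ioo 0 t)), eLpNorm (Φ s) 2 μ ≤ C) :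
    ∫⁻ z, ‖⟪Φ z.1 z.2, B z.1 z.2⟫‖ₑ ∂((volume.restrict (Ioo 0 t)).prod μ) ≤
      C * ∫⁻ σ in Ioo 0 t, eLpNorm (B σ) 2 μ := by
  set νt : Measure ℝ := volume.restrict (Ioo 0 t) with hνt
  have hNBm : Measurable fun σ => eLpNorm (B σ) 2 μ := measurable_eLpNorm_slice hB 2
  have hmeas : AEMeasurable (fun z : ℝ × X => ‖⟪Φ z.1 z.2, B z.1 z.2⟫‖ₑ) (νt.prod μ) :=
    (hΦ.inner hB).aestronglyMeasurable.enorm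
  calc ∫⁻ z, ‖⟪Φ z.1 z.2, B z.1 z.2⟫‖ₑ ∂(νt.prod μ)
      = ∫⁻ σ, ∫⁻ x, ‖⟪Φ σ x, B σ x⟫‖ₑ ∂μ ∂νt := lintegral_prod _ hmeas
    _ ≤ ∫⁻ σ, eLpNorm (Φ σ) 2 μ * eLpNorm (B σ) 2 μ ∂νt :=
        lintegral_mono fun σ => lintegral_enorm_inner_le_eLpNorm_mul
          (aestronglyMeasurable_slice_of_uncurry hΦ σ) (aestronglyMeasurable_slice_of_uncurry hB σ)
    _ ≤ ∫⁻ σ, C * eLpNorm (B σ) 2 μ ∂νt := by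
        refine lintegral_mono_ae ?_
        filter_upwards [hΦC] with σ hσ
        exact mul_le_mul' hσ le_rfl
    _ = C * ∫⁻ σ, eLpNorm (B σ) 2 μ ∂νt := lintegral_const_mul'' _ hNBm.aemeasurable

omit [CompleteSpace V] in
/-- The kernel-weighted pairing of a bounded kernel against an `L¹_tL²_x` field and an a.e.
`L²`-bounded field is integrable on the time square (the mollified force pairings of Serrin's
doubled-time identity are genuine integrals). [cite: Serrin1963, §4] -/
theorem integrable_normed_mul_integral_inner_of_L1 (φ : ContDiffBump (0 : ℝ)) {t : ℝ}
    {B Φ : ℝ → X → V} (hB : StronglyMeasurable (uncurry B)) (hΦ : StronglyMeasurable (uncurry Φ))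
    (hB1 : ∫⁻ σ in Ioo 0 t, eLpNorm (B σ) 2 μ < ∞)
    {C : ℝ≥0∞} (hC : C < ∞) (hΦC : ∀ᵐ s ∂(volume.restrict (Ioo 0 t)), eLpNorm (Φ s) 2 μ ≤ C) :
    Integrable (fun p : ℝ × ℝ => φ.normed volume (p.2 - p.1) * ∫ x, ⟪Φ p.2 x, B p.1 x⟫ ∂μ)
      ((volume.restrict (Ioo 0 t)).prod (volume.restrict (Ioo 0 t))) := by
  have h1 : StronglyMeasurable fun p : ℝ × ℝ => ∫ x, ⟪Φ p.2 x, B p.1 x⟫ ∂μ := by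
    have h2 : StronglyMeasurable fun z : (ℝ × ℝ) × X => ⟪Φ z.1.2 z.2, B z.1.1 z.2⟫ :=
      (hΦ.comp_measurable (measurable_fst.snd.prodMk measurable_snd)).inner (𝕜 := ℝ)
        (hB.comp_measurable (measurable_fst.fst.prodMk measurable_snd))
    exact h2.integral_prod_right'
  have hm : AEStronglyMeasurable
      (fun p : ℝ × ℝ => φ.normed volume (p.2 - p.1) * ∫ x, ⟪Φ p.2 x, B p.1 x⟫ ∂μ)
      ((volume.restrict (Ioo 0 t)).prod (volume.restrict (Ioo 0 t))) :=
    (((φ.continuous_normed.comp (continuous_snd.sub continuous_fst)).stronglyMeasurable).mul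
      h1).aestronglyMeasurable
  refine ⟨hm, ?_⟩
  rw [hasFiniteIntegral_iff_enorm]
  exact (lintegral_enorm_normed_mul_integral_inner_le φ hB hΦ hΦC).trans_lt
    (ENNReal.mul_lt_top hC hB1)

omit [CompleteSpace V] in
/-- The diagonal pairing of an `L¹_tL²_x` field with an a.e. `L²`-bounded field is integrable on
`(0,t) × X` (the limiting force pairing `∫₀ᵗ⟨f, v⟩` of Serrin's identity is a genuine integral).
[cite: Serrin1963, §4] -/
theorem integrable_inner_prod_of_L1 {t : ℝ} {B Φ : ℝ → X → V}
    (hB : StronglyMeasurable (uncurry B)) (hΦ : StronglyMeasurable (uncurry Φ))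
    (hB1 : ∫⁻ σ in Ioo 0 t, eLpNorm (B σ) 2 μ < ∞)
    {C : ℝ≥0∞} (hC : C < ∞) (hΦC : ∀ᵐ s ∂(volume.restrict (Ioo 0 t)), eLpNorm (Φ s) 2 μ ≤ C) :
    Integrable (fun z : ℝ × X => ⟪Φ z.1 z.2, B z.1 z.2⟫) ((volume.restrict (Ioo 0 t)).prod μ) := by
  refine ⟨(hΦ.inner hB).aestronglyMeasurable, ?_⟩
  rw [hasFiniteIntegral_iff_enorm]
  exact (lintegral_enorm_inner_prod_le hB hΦ hΦC).trans_lt (ENNReal.mul_lt_top hC hB1)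

/-- **The mollified `L¹_tL²_x`–`L^∞_tL²_x` pairing converges.** Let `A, Φ : ℝ × X → V` be jointly
measurable, `∫_{(0,t)} ‖A(σ)‖_{L²(X)} dσ < ∞`, `‖Φ(s)‖_{L²(X)} ≤ C < ∞` for a.e. `s ∈ (0,t)`, and let
`ρₙ` be normalised bump kernels with `rOut(ρₙ) → 0`. Then
`∫∫_{(0,t)²} ρₙ(s - σ) ⟨Φ(s), A(σ)⟩_{L²(X)} dσ ds → ∫_{(0,t)} ⟨Φ(s), A(s)⟩_{L²(X)} ds`
(Serrin 1963, §4 / Sohr 2001, proof of Thm. V.1.4.1: the passage to the limit in the mollification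
for the FORCE pairings `∫⟨f, v⟩` of the cross-tested weak formulations, `f ∈ L¹(0,T;L²)`,
`v ∈ L^∞(0,T;L²)`). Proof: time-truncation of `A` at slice norm `M`, the accepted `L²`–`L²` lemma
for the truncated part, and the uniform remainder bound
`lintegral_enorm_normed_mul_integral_inner_le`. [cite: Serrin1963, §4] -/
theorem tendsto_integral_normed_mul_integral_inner_of_L1 {φ : ℕ → ContDiffBump (0 : ℝ)}
    (hφ : Tendsto (fun n => (φ n).rOut) atTop (𝓝 0))
    {t : ℝ} {A Φ : ℝ → X → V} (hA : StronglyMeasurable (uncurry A))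
    (hΦ : StronglyMeasurable (uncurry Φ))
    (hA1 : ∫⁻ σ in Ioo 0 t, eLpNorm (A σ) 2 μ < ∞)
    {C : ℝ≥0∞} (hC : C < ∞) (hΦC : ∀ᵐ s ∂(volume.restrict (Ioo 0 t)), eLpNorm (Φ s) 2 μ ≤ C) :
    Tendsto (fun n => ∫ p, (φ n).normed volume (p.2 - p.1) * ∫ x, ⟪Φ p.2 x, A p.1 x⟫ ∂μ
        ∂((volume.restrict (Ioo 0 t)).prod (volume.restrict (Ioo 0 t))))
      atTop (𝓝 (∫ z, ⟪Φ z.1 z.2, A z.1 z.2⟫ ∂((volume.restrict (Ioo 0 t)).prod μ))) := by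
  set νt : Measure ℝ := volume.restrict (Ioo 0 t) with hνt
  haveI : IsFiniteMeasure νt := by rw [hνt]; infer_instance
  set NA : ℝ → ℝ≥0∞ := fun σ => eLpNorm (A σ) 2 μ with hNA
  have hNAm : Measurable NA := measurable_eLpNorm_slice hA 2
  -- ### the time truncation sets and the tails
  set S : ℕ → Set ℝ := fun M => {σ | NA σ ≤ (M : ℝ≥0∞)} with hS
  have hSm : ∀ M, MeasurableSet (S M) := fun M => measurableSet_le hNAm measurable_const
  set tail : ℕ → ℝ≥0∞ := fun M => ∫⁻ σ, (S M)ᶜ.indicator NA σ ∂νt with htail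
  have htail0 : Tendsto tail atTop (𝓝 0) := by
    have hlim : ∀ᵐ σ ∂νt, Tendsto (fun M => (S M)ᶜ.indicator NA σ) atTop (𝓝 0) := by
      filter_upwards [ae_lt_top hNAm hA1.ne] with σ hσ
      obtain ⟨M₀, hM₀⟩ := ENNReal.exists_nat_gt hσ.ne
      refine tendsto_atTop_of_eventually_const (i₀ := M₀) fun M hM => ?_
      have hmem : σ ∈ S M := by
        show NA σ ≤ (M : ℝ≥0∞)
        exact hM₀.le.trans (by exact_mod_cast hM)
      exact indicator_of_notMem (Set.notMem_compl_iff.2 hmem) _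
    have h := tendsto_lintegral_of_dominated_convergence NA
      (fun M => (hNAm.indicator (hSm M).compl)) (fun M => ae_of_all _ fun σ =>
        indicator_le_self _ _ σ) hA1.ne hlim
    simpa [htail] using h
  -- ### ε / 3
  rw [Metric.tendsto_atTop]
  intro ε hε
  have hε3 : 0 < ε / 3 := by positivity
  have hCtail : Tendsto (fun M => C * tail M) atTop (𝓝 0) := by
    have h := ENNReal.Tendsto.const_mul htail0 (Or.inr hC.ne)
    rwa [mul_zero] at h
  obtain ⟨M, hM⟩ : ∃ M, C * tail M < ENNReal.ofReal (ε / 3) :=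
    (hCtail.eventually (gt_mem_nhds (ENNReal.ofReal_pos.2 hε3))).exists
  -- the splitting `A = A₁ + A₂`
  set A₁ : ℝ → X → V := fun σ x => (S M).indicator (fun σ => A σ x) σ with hA₁
  set A₂ : ℝ → X → V := fun σ x => (S M)ᶜ.indicator (fun σ => A σ x) σ with hA₂
  have hSMz : MeasurableSet {z : ℝ × X | z.1 ∈ S M} := (hSm M).preimage measurable_fst
  have hA₁eq : uncurry A₁ = {z : ℝ × X | z.1 ∈ S M}.indicator (uncurry A) := by
    ext z; simp only [hA₁, uncurry, indicator_apply, mem_setOf_eq]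
  have hA₂eq : uncurry A₂ = {z : ℝ × X | z.1 ∈ S M}ᶜ.indicator (uncurry A) := by
    ext z; simp only [hA₂, uncurry, indicator_apply, mem_setOf_eq, mem_compl_iff]
  have hA₁m : StronglyMeasurable (uncurry A₁) := by rw [hA₁eq]; exact hA.indicator hSMz
  have hA₂m : StronglyMeasurable (uncurry A₂) := by rw [hA₂eq]; exact hA.indicator hSMz.compl
  have hA₁mem : ∀ {σ}, σ ∈ S M → A₁ σ = A σ := fun {σ} hσ => by
    ext x; simp only [hA₁]; exact indicator_of_mem hσ _
  have hA₁nmem : ∀ {σ}, σ ∉ S M → A₁ σ = 0 := fun {σ} hσ => by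
    ext x; simp only [hA₁, Pi.zero_apply]; exact indicator_of_notMem hσ _
  have hA₂mem : ∀ {σ}, σ ∈ S M → A₂ σ = 0 := fun {σ} hσ => by
    ext x; simp only [hA₂, Pi.zero_apply]
    exact indicator_of_notMem (Set.notMem_compl_iff.2 hσ) _
  have hA₂nmem : ∀ {σ}, σ ∉ S M → A₂ σ = A σ := fun {σ} hσ => by
    ext x; simp only [hA₂]; exact indicator_of_mem (Set.mem_compl hσ) _
  -- slice norms of the two parts
  have hNA₁ : ∀ σ, eLpNorm (A₁ σ) 2 μ = (S M).indicator NA σ := by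
    intro σ
    by_cases hσ : σ ∈ S M
    · rw [indicator_of_mem hσ, hA₁mem hσ]
    · rw [indicator_of_notMem hσ, hA₁nmem hσ, eLpNorm_zero]
  have hNA₂ : ∀ σ, eLpNorm (A₂ σ) 2 μ = (S M)ᶜ.indicator NA σ := by
    intro σ
    by_cases hσ : σ ∈ S M
    · rw [indicator_of_notMem (Set.notMem_compl_iff.2 hσ), hA₂mem hσ, eLpNorm_zero]
    · rw [indicator_of_mem (Set.mem_compl hσ), hA₂nmem hσ]
  have hA₁1 : ∫⁻ σ in Ioo 0 t, eLpNorm (A₁ σ) 2 μ < ∞ := by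
    refine lt_of_le_of_lt (lintegral_mono fun σ => ?_) hA1
    rw [hNA₁]; exact indicator_le_self _ _ σ
  have hA₂1 : ∫⁻ σ in Ioo 0 t, eLpNorm (A₂ σ) 2 μ = tail M := by
    simp only [htail, hNA₂]
    rfl
  have hA₂1' : ∫⁻ σ in Ioo 0 t, eLpNorm (A₂ σ) 2 μ < ∞ := by
    rw [hA₂1]
    refine lt_of_le_of_lt (lintegral_mono fun σ => indicator_le_self _ _ σ) hA1
  -- the pointwise splitting of the pairings
  have hsplit : ∀ s σ, ∫ x, ⟪Φ s x, A σ x⟫ ∂μ =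
      (∫ x, ⟪Φ s x, A₁ σ x⟫ ∂μ) + ∫ x, ⟪Φ s x, A₂ σ x⟫ ∂μ := by
    intro s σ
    by_cases hσ : σ ∈ S M
    · simp [hA₁mem hσ, hA₂mem hσ]
    · simp [hA₁nmem hσ, hA₂nmem hσ]
  have hsplit' : ∀ z : ℝ × X, ⟪Φ z.1 z.2, A z.1 z.2⟫ =
      ⟪Φ z.1 z.2, A₁ z.1 z.2⟫ + ⟪Φ z.1 z.2, A₂ z.1 z.2⟫ := by
    intro z
    by_cases hσ : z.1 ∈ S M
    · simp [hA₁mem hσ, hA₂mem hσ]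
    · simp [hA₁nmem hσ, hA₂nmem hσ]
  -- ### the truncated part is `L²`–`L²`
  have hA₁2 : eLpNorm (uncurry A₁) 2 (νt.prod μ) < ∞ := by
    have hsq : eLpNorm (uncurry A₁) 2 (νt.prod μ) ^ (2 : ℝ) < ∞ := by
      rw [← lintegral_eLpNorm_slice_sq hA₁m]
      calc ∫⁻ σ, eLpNorm (A₁ σ) 2 μ ^ (2 : ℝ) ∂νt ≤ ∫⁻ σ, (M : ℝ≥0∞) * NA σ ∂νt := by
            refine lintegral_mono fun σ => ?_
            rw [hNA₁]
            by_cases hσ : σ ∈ S M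
            · rw [indicator_of_mem hσ, show (2 : ℝ) = 1 + 1 by norm_num,
                ENNReal.rpow_add_of_nonneg _ _ zero_le_one zero_le_one, ENNReal.rpow_one]
              exact mul_le_mul' hσ le_rfl
            · rw [indicator_of_notMem hσ, ENNReal.zero_rpow_of_pos two_pos]
              exact bot_le
        _ = (M : ℝ≥0∞) * ∫⁻ σ, NA σ ∂νt := lintegral_const_mul'' _ hNAm.aemeasurable
        _ < ∞ := ENNReal.mul_lt_top (ENNReal.natCast_lt_top M) hA1
    exact (ENNReal.rpow_lt_top_iff_of_pos two_pos).1 hsq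
  have hΦ2 : eLpNorm (uncurry Φ) 2 (νt.prod μ) < ∞ := by
    have hsq : eLpNorm (uncurry Φ) 2 (νt.prod μ) ^ (2 : ℝ) < ∞ := by
      rw [← lintegral_eLpNorm_slice_sq hΦ]
      calc ∫⁻ s, eLpNorm (Φ s) 2 μ ^ (2 : ℝ) ∂νt ≤ ∫⁻ _s, C ^ (2 : ℝ) ∂νt :=
            lintegral_mono_ae (by
              filter_upwards [hΦC] with s hs
              exact ENNReal.rpow_le_rpow hs zero_le_two)
        _ = C ^ (2 : ℝ) * νt univ := lintegral_const _
        _ < ∞ := ENNReal.mul_lt_top (ENNReal.rpow_lt_top_of_nonneg zero_le_two hC.ne)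
            (measure_lt_top _ _)
    exact (ENNReal.rpow_lt_top_iff_of_pos two_pos).1 hsq
  have hlim₁ := tendsto_integral_normed_mul_integral_inner (μ := μ) hφ hA₁m hΦ hA₁2 hΦ2
  obtain ⟨N, hN⟩ := (Metric.tendsto_atTop.1 hlim₁) (ε / 3) hε3
  refine ⟨N, fun n hn => ?_⟩
  -- ### the three pieces
  set I : ℕ → (ℝ → X → V) → ℝ := fun n B =>
    ∫ p, (φ n).normed volume (p.2 - p.1) * ∫ x, ⟪Φ p.2 x, B p.1 x⟫ ∂μ ∂(νt.prod νt) with hI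
  set J : (ℝ → X → V) → ℝ := fun B => ∫ z, ⟪Φ z.1 z.2, B z.1 z.2⟫ ∂(νt.prod μ) with hJ
  have hIsplit : I n A = I n A₁ + I n A₂ := by
    simp only [hI]
    rw [← integral_add (integrable_normed_mul_integral_inner_of_L1 (φ n) hA₁m hΦ hA₁1 hC hΦC)
      (integrable_normed_mul_integral_inner_of_L1 (φ n) hA₂m hΦ hA₂1' hC hΦC)]
    refine integral_congr_ae (ae_of_all _ fun p => ?_)
    dsimp only
    rw [hsplit p.2 p.1, mul_add]
  have hJsplit : J A = J A₁ + J A₂ := by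
    simp only [hJ]
    rw [← integral_add (integrable_inner_prod_of_L1 hA₁m hΦ hA₁1 hC hΦC)
      (integrable_inner_prod_of_L1 hA₂m hΦ hA₂1' hC hΦC)]
    exact integral_congr_ae (ae_of_all _ fun z => hsplit' z)
  have hsmall : (C * tail M).toReal < ε / 3 := by
    have h := (ENNReal.toReal_lt_toReal (hM.trans ENNReal.ofReal_lt_top).ne
      ENNReal.ofReal_ne_top).2 hM
    rwa [ENNReal.toReal_ofReal hε3.le] at h
  have hI₂ : ‖I n A₂‖ < ε / 3 := by
    have h1 : ‖I n A₂‖ₑ ≤ C * tail M := by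
      rw [← hA₂1]
      exact (enorm_integral_le_lintegral_enorm _).trans
        (lintegral_enorm_normed_mul_integral_inner_le (φ n) hA₂m hΦ hΦC)
    have h2 : ‖I n A₂‖ ≤ (C * tail M).toReal := by
      rw [← toReal_enorm]
      exact ENNReal.toReal_mono (hM.trans ENNReal.ofReal_lt_top).ne h1
    exact h2.trans_lt hsmall
  have hJ₂ : ‖J A₂‖ < ε / 3 := by
    have h1 : ‖J A₂‖ₑ ≤ C * tail M := by
      rw [← hA₂1]
      exact (enorm_integral_le_lintegral_enorm _).trans
        (lintegral_enorm_inner_prod_le hA₂m hΦ hΦC)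
    have h2 : ‖J A₂‖ ≤ (C * tail M).toReal := by
      rw [← toReal_enorm]
      exact ENNReal.toReal_mono (hM.trans ENNReal.ofReal_lt_top).ne h1
    exact h2.trans_lt hsmall
  have hmid : dist (I n A₁) (J A₁) < ε / 3 := hN n hn
  -- ### assemble
  show dist (I n A) (J A) < ε
  rw [hIsplit, hJsplit, dist_eq_norm]
  calc ‖I n A₁ + I n A₂ - (J A₁ + J A₂)‖ = ‖(I n A₁ - J A₁) + I n A₂ - J A₂‖ := by ring_nf
    _ ≤ ‖(I n A₁ - J A₁) + I n A₂‖ + ‖J A₂‖ := norm_sub_le _ _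
    _ ≤ ‖I n A₁ - J A₁‖ + ‖I n A₂‖ + ‖J A₂‖ := by gcongr; exact norm_add_le _ _
    _ < ε / 3 + ε / 3 + ε / 3 := by
        have h1 : ‖I n A₁ - J A₁‖ < ε / 3 := by rwa [← dist_eq_norm]
        linarith
    _ = ε := by ring

/-- **The mollified `L^∞_tL²_x`–`L¹_tL²_x` pairing converges** (the roles of the two classes
exchanged): for jointly measurable `A, Φ` with `‖A(σ)‖_{L²} ≤ C < ∞` for a.e. `σ ∈ (0,t)` and
`∫_{(0,t)} ‖Φ(s)‖_{L²} ds < ∞`,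
`∫∫_{(0,t)²} ρₙ(s - σ) ⟨Φ(s), A(σ)⟩_{L²} dσ ds → ∫_{(0,t)} ⟨Φ(s), A(s)⟩_{L²} ds`
(swap the two time variables: the kernels are even and the real inner product is symmetric).
[cite: Serrin1963, §4] -/
theorem tendsto_integral_normed_mul_integral_inner_of_L1' {φ : ℕ → ContDiffBump (0 : ℝ)}
    (hφ : Tendsto (fun n => (φ n).rOut) atTop (𝓝 0))
    {t : ℝ} {A Φ : ℝ → X → V} (hA : StronglyMeasurable (uncurry A))
    (hΦ : StronglyMeasurable (uncurry Φ))
    (hΦ1 : ∫⁻ s in Ioo 0 t, eLpNorm (Φ s) 2 μ < ∞)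
    {C : ℝ≥0∞} (hC : C < ∞) (hAC : ∀ᵐ σ ∂(volume.restrict (Ioo 0 t)), eLpNorm (A σ) 2 μ ≤ C) :
    Tendsto (fun n => ∫ p, (φ n).normed volume (p.2 - p.1) * ∫ x, ⟪Φ p.2 x, A p.1 x⟫ ∂μ
        ∂((volume.restrict (Ioo 0 t)).prod (volume.restrict (Ioo 0 t))))
      atTop (𝓝 (∫ z, ⟪Φ z.1 z.2, A z.1 z.2⟫ ∂((volume.restrict (Ioo 0 t)).prod μ))) := by
  set νt : Measure ℝ := volume.restrict (Ioo 0 t) with hνt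
  have h := tendsto_integral_normed_mul_integral_inner_of_L1 (μ := μ) hφ hΦ hA hΦ1 hC hAC
  have h1 : ∀ n, (∫ p, (φ n).normed volume (p.2 - p.1) * ∫ x, ⟪Φ p.2 x, A p.1 x⟫ ∂μ
      ∂(νt.prod νt)) = ∫ p, (φ n).normed volume (p.2 - p.1) * ∫ x, ⟪A p.2 x, Φ p.1 x⟫ ∂μ
      ∂(νt.prod νt) := by
    intro n
    rw [← integral_prod_swap]
    refine integral_congr_ae (ae_of_all _ fun p => ?_)
    simp only [Prod.swap]
    rw [normed_sub_comm (φ n) p.1 p.2]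
    congr 1
    exact integral_congr_ae (ae_of_all _ fun x => real_inner_comm _ _)
  have h2 : (∫ z, ⟪Φ z.1 z.2, A z.1 z.2⟫ ∂(νt.prod μ)) = ∫ z, ⟪A z.1 z.2, Φ z.1 z.2⟫ ∂(νt.prod μ) :=
    integral_congr_ae (ae_of_all _ fun z => real_inner_comm _ _)
  rw [h2]
  exact h.congr fun n => (h1 n).symm

end L1Pairing

end Literature.Analysis.FunctionSpaces

end
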